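import Summits.Parity.GeneralizedHardyLittlewood.Theses.LeeYangFibres
import Summits.Parity.GeneralizedHardyLittlewood.Theorems.LeeYangFibresHyperbolicityClipsParityPrep
import HarnessLib

/-!
# Route `LeeYangFibres`, crux `CellParityLaw` (stmt-Parity-14109), line `section-annihilator`:
# the relative + absolute form of the crux (vocabulary, skeleton v16)

Route-posited statement type (D-0016 `<Route><Crux>…Defs` file; companion of
`LeeYangFibresCellParityLawDefs.lean`, `…SieveDefs.lean`, `…KernelDefs.lean`). One `def … : Prop` — the type
`CellParityLawRel` — and the registered bookkeeping stub `stub_relOfAbs : CellParityLaw → CellParityLawRel`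
(the crux as typed implies it; pure bookkeeping).

## Why (lead c4, 2026-08-16)

After four leads the crux `CellParityLaw` is closed modulo exactly two statements (conditional closure
`stub_conditionalClosure`, `…Conditional.lean`, p118217): the ATOM `∀ t ≥ 1, SectionLevelAt t` (typed tuple-GEH at
level `N^{1-(log log N)^{-B}}`) and the KERNEL `EffectiveRoughCellLaw` (Bombieri's asymptotic-sieve completeness for
rough `Ω`-cells with a POLYNOMIAL rate in the level deficit — unpublished). Both non-printed features — the atom's
level tending to `1` at the quantified speed `(log log N)^{-B}`, and the kernel's polynomial rate — are forced by ONE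
feature of the crux's typing: its error `ε N / log^t N` is purely ABSOLUTE, while on discriminant-rich systems
(primorial shifts, `∏_p β_p(Ψ) ≍ (log log N)^{t-1}`, inhabited: `LeeYangFibresAbsoluteUpgradeHighMass`) the main
term is `≍ (log log N)^{t-1} N / log^t N`, so the crux demands RELATIVE accuracy `ε (log log N)^{1-t}`; a finite
level `N^{1-η₀}` or a qualitative / logarithmic rate `ρ(η)` can never deliver that (`η ≥ (t+2) log log N / log N`
is forced by the localisation `Λ = (log N)^{t+2}`, so `log(1/η) ≤ log log N`).

The route, however, consumes the crux only through `HyperbolicityClipsParity : CellParityLaw → FibreHyperbolicity →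
ModelCellFacts → PrimeCellsRelative`, whose output `PrimeCellsRelative` carries Green–Tao's RELATIVE + absolute
error `ε (β_∞ ∏β_p (A₁(N)/N)^t + N / log^t N)` and whose proof (`clipsParity_assembly`) uses the law's error only
relative to the fibre scale `β_∞ ∏β_p · a_m a₁^{t-1}` once `β_∞ ∏β_p ≥ ηN` (and trivially below). The type below,
`CellParityLawRel`, is the crux with exactly that error shape — verbatim `CellParityLaw` with the right-hand side
`ε * N / Real.log N ^ t` replaced by `ε * (archFactor Ψ K * singularProduct Ψ * (A₁(N)/N)^t + N / Real.log N ^ t)`,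
the shape of `PrimeCellsRelative`. The companion file `LeeYangFibresCellParityLawRelConsumer.lean` proves
`CellParityLawRel → FibreHyperbolicity → ModelCellFacts → PrimeCellsRelative` (the consumer needs no more), and
`stub_relOfAbs` below records `CellParityLaw → CellParityLawRel`. For the relative form, fixed RELATIVE accuracy
`ε` per layer of the Walsh induction suffices, hence a FIXED level deficit `η₀(ε, t, u, L)` (the atom at level
`N^{1-η₀}` for every `η₀ > 0`: the standard fixed-level shape of tuple-GEH) and ANY rate `ρ(η) → 0` of the kernel
(the qualitative uniform Bombieri–Friedlander–Iwaniec law, printed: FI 1978 §4 + Bombieri 1977). Recorded for the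
tenure planner as the candidate restatement of the item; nothing here asserts `CellParityLawRel`.

References: B. Green, T. Tao, Ann. of Math. 171 (2010), Conj. 1.4 [GreenTao2010]; E. Bombieri, RIMS Kôkyûroku 294
(1977) [BombieriRIMS1977]; J. Friedlander, H. Iwaniec, Ann. Sc. Norm. Sup. Pisa (4) 5 (1978) §4
[FriedlanderIwaniecPisa1978].
-/

noncomputable section

open scoped BigOperators Classical
open Finset Literature.NumberTheory.Sieve

namespace Summit.Parity.GeneralizedHardyLittlewood.Cruxes.CellParityLaw.SectionAnnihilator

/-- **The cell-parity law with Green–Tao's relative + absolute error** (`CellParityLawRel`; candidate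
restatement of crux stmt-Parity-14109, lead c4). Verbatim `LeeYangFibres.CellParityLaw` — same objects, same
amplitudes `θ` (`θ_∅ = 1`, `|θ_S| ≤ 2`), same model `Θ(parity vector of j) · β_∞ ∏_p β_p · ∏_i A_{j_i}(N)/N` —
except that the error `ε N / log^t N` becomes
`ε · (β_∞(Ψ,K) ∏_p β_p(Ψ) · (A₁(N)/N)^t + N / log^t N)`, `A₁(N) = #{m ≤ N : P⁻(m) > N^{1/u}, Ω(m) = 1}` —
the error shape of the route's node `PrimeCellsRelative` (Green–Tao Conj. 1.4). Equal to the crux on systems of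
bounded singular product; weaker exactly on the discriminant-rich systems `∏_p β_p ≍ (log log N)^{t-1}`. A
statement type, NOT asserted here. -/
def CellParityLawRel : Prop :=
  ∀ (t L u : ℕ), 1 ≤ t → 2 ≤ u → ∀ ε : ℝ, 0 < ε → ∃ N₀ : ℕ, ∀ N : ℕ, N₀ ≤ N →
    ∀ Ψ : Fin t → AffLinForm 1, IsNondegenerateSystem Ψ → affLinSize Ψ N ≤ L →
    ∀ K : Set (Fin 1 → ℝ), Convex ℝ K → K ⊆ realBox 1 N →
    ∃ θ : Finset (Fin t) → ℝ, θ ∅ = 1 ∧ (∀ S, |θ S| ≤ 2) ∧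
      ∀ j : Fin t → ℕ, (∀ i, 1 ≤ j i ∧ j i ≤ u) →
        |((((latticeBox 1 N).filter (fun n => realPoint n ∈ K ∧
              ∀ i, (N : ℝ) ^ ((1 : ℝ) / u) < (Nat.minFac ((Ψ i).eval n).toNat : ℝ) ∧
                ArithmeticFunction.cardFactors ((Ψ i).eval n).toNat = j i)).card : ℕ) : ℝ) -
            (∑ S : Finset (Fin t), θ S * ∏ i ∈ S, (-1 : ℝ) ^ (j i + 1)) *
              (archFactor Ψ K * singularProduct Ψ *
                ∏ i, ((((Finset.Icc 1 N).filter (fun m => (N : ℝ) ^ ((1 : ℝ) / u) < (Nat.minFac m : ℝ) ∧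
                  ArithmeticFunction.cardFactors m = j i)).card : ℕ) : ℝ) / N)| ≤
          ε * (archFactor Ψ K * singularProduct Ψ *
                (((((Finset.Icc 1 N).filter (fun m => (N : ℝ) ^ ((1 : ℝ) / u) < (Nat.minFac m : ℝ) ∧
                  ArithmeticFunction.cardFactors m = 1)).card : ℕ) : ℝ) / N) ^ t +
              N / Real.log N ^ t)

/-- **`stub_relOfAbs`** (registered bookkeeping stub of skeleton v16, line `section-annihilator`): the crux as
typed implies its relative + absolute form — `ε N / log^t N ≤ ε (X + N / log^t N)` because the scale
`X = β_∞ ∏_p β_p (A₁/N)^t` is non-negative for non-degenerate systems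
(`archFactor_mul_singularProduct_nonneg`). Pure bookkeeping. -/
theorem stub_relOfAbs :
    Summit.Parity.GeneralizedHardyLittlewood.Theses.LeeYangFibres.CellParityLaw → CellParityLawRel := by
  intro hLaw t L u ht hu ε hε
  obtain ⟨N₀, hN₀⟩ := hLaw t L u ht hu ε hε
  refine ⟨N₀, fun N hN Ψ hΨ hsize K hK hKbox => ?_⟩
  obtain ⟨θ, hθ0, hθ2, hcells⟩ := hN₀ N hN Ψ hΨ hsize K hK hKbox
  refine ⟨θ, hθ0, hθ2, fun j hj => (hcells j hj).trans ?_⟩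
  have hX : 0 ≤ archFactor Ψ K * singularProduct Ψ *
      (((((Finset.Icc 1 N).filter (fun m => (N : ℝ) ^ ((1 : ℝ) / u) < (Nat.minFac m : ℝ) ∧
        ArithmeticFunction.cardFactors m = 1)).card : ℕ) : ℝ) / N) ^ t :=
    mul_nonneg (Theorems.HyperbolicityClipsParity.archFactor_mul_singularProduct_nonneg Ψ hΨ K)
      (by positivity)
  rw [mul_div_assoc]
  exact mul_le_mul_of_nonneg_left (le_add_of_nonneg_left hX) hε.le

end Summit.Parity.GeneralizedHardyLittlewood.Cruxes.CellParityLaw.SectionAnnihilator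

end
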